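import Literature.AlgebraicGeometry.Resolution.StrictTransformFlattening
import HarnessLib

/-!
# Persistence of flat strict transforms under dominating blowing ups

Topic: `Literature/AlgebraicGeometry/Resolution`. A step towards the reduction of Raynaud–Gruson
flattening (Stacks, Tag 081R; the named fact `Stacks081R` of `StrictTransformFlattening.lean`)
to the case of an affine source: in the printed proof of 081R ("Since `X` is quasi-compact we
can find a finite affine open covering `X = ⋃ Xᵢ`. If we can find `U`-admissible blowups
`bᵢ : Sᵢ → S` such that the strict transform of `Xᵢ` is flat and of finite presentation over
`Sᵢ`, then …") the flat strict transforms along the `bᵢ` have to survive the passage to a single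
`U`-admissible blowing up `b : S' → S` dominating the `bᵢ` (Tag 080N,
`AdmissibleBlowups.lean`). This file PROVES that persistence, in the following form
(`blowupStrictTransform`, Stacks 080D (2): the scheme-theoretic closure of
`(X ×_S S')|_{b⁻¹(S ∖ V(𝓘))}` in `X ×_S S'`):

* `IsEffectiveCartier.isCompact_inter_centreCompl`, `….quasiCompact_ι_centreCompl` — the
  complement of an effective Cartier divisor is retrocompact (Stacks 07ZU: the complement of a
  locally principal closed subscheme is retrocompact; locally it is a basic open `D(f)`);
* `IsEffectiveCartier.app_ι_centreCompl_injective`,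
  `….isSchemeTheoreticallyDominant_ι_centreCompl` — **an effective Cartier divisor is nowhere
  dense scheme-theoretically**: the open immersion of its complement is scheme-theoretically
  dominant (a section vanishing off `V(f)`, `f` regular, vanishes: `Γ(W) → Γ(W)[1/f]` is
  injective; Stacks 07ZU/01WS);
* `isSchemeTheoreticallyDominant_ι_preimage_centreCompl` — hence for `g : T → S'` FLAT and `E`
  an effective Cartier divisor of `S'`, the open `g⁻¹(S' ∖ E) ⊆ T` is scheme-theoretically
  dense (Mathlib: scheme-theoretic dominance of quasi-compact morphisms is stable under flat base
  change, `IsSchemeTheoreticallyDominant.of_isPullback`);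
* `eq_ker_ι_preimage_centreCompl_of_flat` — **uniqueness of the strict transform along a
  blowing up** (the analogue of de Jong 1996, 2.18, last sentence, proved in
  `StrictTransformFlattening.lean` over an integral base): a closed subscheme `V(J) ⊆ T`, flat
  over `S'` and containing the scheme-theoretic closure of `T|_{g⁻¹(S' ∖ E)}`, IS that closure;
* `comap_ker_self_eq_bot` — `f⁻¹(ker f) 𝒪 = 0`: a morphism factors through its scheme-theoretic
  image;
* `ker_blowupStrictTransformι_eq_comap` and its corollaries
  `flat_blowupStrictTransformMap_of_dominating`,
  `blowupStrictTransformMap_of_dominating` — **persistence**: let `bᵢ : Sᵢ → S`, `b : S' → S`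
  with `b = g ≫ bᵢ`, ideal sheaves `𝓘ᵢ`, `𝓘` on `S` with `Supp 𝓘ᵢ ⊆ Supp 𝓘` (e.g. `𝓘 = ∏ 𝓘ⱼ`)
  and `b⁻¹𝓘 𝒪_{S'}` an effective Cartier divisor (e.g. `b` a blowing up in `𝓘`). If the strict
  transform `X'ᵢ → Sᵢ` of `f : X → S` along `bᵢ` is flat, then the strict transform of `f`
  along `b` is the base change `X'ᵢ ×_{Sᵢ} S' ⊆ X ×_S S'`, hence flat, and it inherits every
  property of `X'ᵢ → Sᵢ` stable under base change (e.g. locally of finite presentation).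
  Proof: `X'ᵢ ×_{Sᵢ} S'` is a closed subscheme of `X ×_S S' = (X ×_S Sᵢ) ×_{Sᵢ} S'`, flat over
  `S'`, equal to `X ×_S S'` over `g⁻¹(bᵢ⁻¹(S ∖ V(𝓘ᵢ))) ⊇ b⁻¹(S ∖ V(𝓘))`; by uniqueness it is
  the strict transform. (This is the flat case of "the strict transform of a flat module is its
  pull-back", Stacks 080F/0CZR, combined with the compatibility of strict transforms with
  compositions of blowing ups.)

## References

* The Stacks Project, Tag 081R (proof, first paragraph), Tag 080D (strict transform),
  Tag 07ZU, Tag 01WS (effective Cartier divisors), Tag 080N. [StacksProject]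
* A. J. de Jong, *Smoothness, semi-stability and alterations*, Publ. Math. IHÉS 83 (1996),
  2.18 (p. 60). [DeJong1996]
* M. Raynaud, L. Gruson, *Critères de platitude et de projectivité*, Invent. Math. 13 (1971),
  Première partie, 5.1–5.2. [RaynaudGruson1971]
-/

noncomputable section

open CategoryTheory CategoryTheory.Limits AlgebraicGeometry TopologicalSpace

namespace Literature.AlgebraicGeometry.Resolution

universe u

/-! ## The complement of an effective Cartier divisor is retrocompact and schematically dense -/

section Cartier

variable {X : Scheme.{u}} {K : X.IdealSheafData}

/-- On an affine open `W` where the effective Cartier ideal sheaf `K` is generated by `f`, the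
complement of the centre is the basic open `D(f)`: `W ∖ V(K) = D(f)`. [folklore] -/
theorem inter_centreCompl_eq_basicOpen (W : X.affineOpens) (f : Γ(X, W))
    (hKW : K.ideal W = Ideal.span {f}) :
    (W : Set X) ∩ (centreCompl K : Set X) = (X.basicOpen f : Set X) := by
  ext y
  constructor
  · rintro ⟨hyW, hyO⟩
    by_contra hyf
    apply hyO
    have hmem : y ∈ X.zeroLocus (U := W) (K.ideal W) ∩ (W : Set X) := by
      refine ⟨?_, hyW⟩
      rw [hKW, Scheme.zeroLocus_span]
      exact (X.mem_zeroLocus_iff _ _).mpr fun g hg => by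
        rw [Set.mem_singleton_iff.mp hg]
        exact hyf
    rw [← Scheme.IdealSheafData.coe_support_inter] at hmem
    exact hmem.1
  · intro hy
    refine ⟨X.basicOpen_le f hy, fun hyK => ?_⟩
    have hmem : y ∈ (K.support : Set X) ∩ W := ⟨hyK, X.basicOpen_le f hy⟩
    rw [Scheme.IdealSheafData.coe_support_inter, hKW, Scheme.zeroLocus_span] at hmem
    exact ((X.mem_zeroLocus_iff _ _).mp hmem.1 f rfl) hy

/-- **The complement of an effective Cartier divisor is retrocompact** (Stacks 07ZU: the
complement of a locally principal closed subscheme is retrocompact): its intersection with every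
affine open is quasi-compact (a finite union of basic opens `D(f)` of small affine opens).
[cite: StacksProject, Tag 07ZU] -/
theorem IsEffectiveCartier.isCompact_inter_centreCompl (hK : IsEffectiveCartier K)
    (U : X.affineOpens) : IsCompact ((U : Set X) ∩ (centreCompl K : Set X)) := by
  classical
  -- affine opens `W_x ∋ x` inside `U` on which `K` is principal
  have hW : ∀ x : (U : Set X), ∃ W : X.affineOpens, (x : X) ∈ (W : X.Opens) ∧
      (W : X.Opens) ≤ U ∧ IsCompact ((W : Set X) ∩ (centreCompl K : Set X)) := by
    intro x
    obtain ⟨V, hxV, f, -, hKV⟩ := hK x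
    obtain ⟨W', hW', hxW', hW'le⟩ := exists_isAffineOpen_mem_and_subset (X := X) (x := (x : X))
      (U := (U : X.Opens) ⊓ V) ⟨x.2, hxV⟩
    have hW'V : W' ≤ (V : X.Opens) := fun y hy => (hW'le hy).2
    refine ⟨⟨W', hW'⟩, hxW', fun y hy => (hW'le hy).1, ?_⟩
    have hKW' : K.ideal ⟨W', hW'⟩ = Ideal.span {X.presheaf.map (homOfLE hW'V).op f} := by
      rw [← K.map_ideal (U := ⟨W', hW'⟩) (V := V) hW'V, hKV, Ideal.map_span, Set.image_singleton]
      rfl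
    rw [inter_centreCompl_eq_basicOpen ⟨W', hW'⟩ _ hKW']
    exact (hW'.basicOpen _).isCompact
  choose W hxW hWU hWc using hW
  obtain ⟨t, ht⟩ := U.2.isCompact.elim_finite_subcover (fun x : (U : Set X) => ((W x : X.Opens) : Set X))
    (fun x => (W x : X.Opens).2) (fun y hy => Set.mem_iUnion.mpr ⟨⟨y, hy⟩, hxW ⟨y, hy⟩⟩)
  have e : (U : Set X) ∩ (centreCompl K : Set X) =
      ⋃ x ∈ t, (((W x : X.Opens) : Set X) ∩ (centreCompl K : Set X)) := by
    apply le_antisymm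
    · rintro y ⟨hyU, hyO⟩
      obtain ⟨x, hx, hyx⟩ := Set.mem_iUnion₂.mp (ht hyU)
      exact Set.mem_iUnion₂.mpr ⟨x, hx, hyx, hyO⟩
    · intro y hy
      obtain ⟨x, -, hyW, hyO⟩ := Set.mem_iUnion₂.mp hy
      exact ⟨hWU x hyW, hyO⟩
  rw [e]
  exact t.isCompact_biUnion fun x _ => hWc x

/-- Hence the open immersion of the complement of an effective Cartier divisor is quasi-compact.
[cite: StacksProject, Tag 07ZU] -/
theorem IsEffectiveCartier.quasiCompact_ι_centreCompl (hK : IsEffectiveCartier K) :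
    QuasiCompact (centreCompl K).ι := by
  refine quasiCompact_iff_forall_isAffineOpen.mpr fun U hU => ?_
  rw [(centreCompl K).ι.isOpenEmbedding.isInducing.isCompact_iff]
  have e : ((centreCompl K).ι.base) '' (((centreCompl K).ι ⁻¹ᵁ U : (centreCompl K : Scheme.{u}).Opens) :
      Set (centreCompl K : Scheme.{u})) = (U : Set X) ∩ (centreCompl K : Set X) := by
    rw [show (((centreCompl K).ι ⁻¹ᵁ U : (centreCompl K : Scheme.{u}).Opens) :
        Set (centreCompl K : Scheme.{u})) = (centreCompl K).ι.base ⁻¹' (U : Set X) from rfl,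
      Set.image_preimage_eq_inter_range, Scheme.Opens.range_ι]
  rw [e]
  exact hK.isCompact_inter_centreCompl ⟨U, hU⟩

/-- **A section vanishing off an effective Cartier divisor vanishes**: restriction from an open
`W` to `W ∖ V(K)` is injective (locally `Γ(W') → Γ(W')[1/f]` with `f` regular; Stacks 01WS: an
effective Cartier divisor's complement is scheme-theoretically dense). [cite: StacksProject, Tag 07ZU] -/
theorem IsEffectiveCartier.app_ι_centreCompl_injective (hK : IsEffectiveCartier K) (W : X.Opens) :
    Function.Injective ((centreCompl K).ι.app W) := by
  rw [injective_iff_map_eq_zero]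
  intro s hs
  refine X.IsSheaf.section_ext fun x hx => ?_
  obtain ⟨V, hxV, f, hf, hKV⟩ := hK x
  obtain ⟨W', hW', hxW', hW'le⟩ := exists_isAffineOpen_mem_and_subset (X := X) (x := x)
    (U := W ⊓ (V : X.Opens)) ⟨hx, hxV⟩
  have hW'W : W' ≤ W := fun y hy => (hW'le hy).1
  have hW'V : W' ≤ (V : X.Opens) := fun y hy => (hW'le hy).2
  refine ⟨W', hW'W, hxW', ?_⟩
  rw [map_zero]
  -- the generator restricted to `W'` is regular and cuts out `V(K) ∩ W'`
  obtain ⟨f', hf'def⟩ : ∃ f' : Γ(X, W'), f' = X.presheaf.map (homOfLE hW'V).op f := ⟨_, rfl⟩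
  have hf' : f' ∈ nonZeroDivisors Γ(X, W') :=
    hf'def ▸ map_mem_nonZeroDivisors_of_le (U := ⟨W', hW'⟩) (V := V) hW'V hf
  have hKW' : K.ideal ⟨W', hW'⟩ = Ideal.span {f'} := by
    rw [← K.map_ideal (U := ⟨W', hW'⟩) (V := V) hW'V, hKV, Ideal.map_span, Set.image_singleton,
      hf'def]
    rfl
  have hD : X.basicOpen f' ≤ centreCompl K := fun y hy =>
    ((inter_centreCompl_eq_basicOpen ⟨W', hW'⟩ f' hKW').symm.subset hy).2
  -- `s` vanishes on `D(f') ⊆ W ∩ (X ∖ V(K))`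
  have hle : X.basicOpen f' ≤ (centreCompl K).ι ''ᵁ (centreCompl K).ι ⁻¹ᵁ W := by
    rw [Scheme.Hom.image_preimage_eq_opensRange_inf, Scheme.Opens.opensRange_ι]
    exact le_inf hD ((X.basicOpen_le f').trans hW'W)
  have hs' : X.presheaf.map (homOfLE (x := (centreCompl K).ι ''ᵁ (centreCompl K).ι ⁻¹ᵁ W) (y := W)
      (Set.image_preimage_subset _ _)).op s = 0 := hs
  have hsD : X.presheaf.map (homOfLE ((X.basicOpen_le f').trans hW'W)).op s = 0 := by
    have h1 : X.presheaf.map (homOfLE ((X.basicOpen_le f').trans hW'W)).op s =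
        X.presheaf.map (homOfLE hle).op (X.presheaf.map (homOfLE
          (x := (centreCompl K).ι ''ᵁ (centreCompl K).ι ⁻¹ᵁ W) (y := W)
          (Set.image_preimage_subset _ _)).op s) := by
      rw [← CommRingCat.comp_apply, ← Functor.map_comp]
      rfl
    rw [h1, hs', map_zero]
  -- hence `s|_{W'} = 0`, the localisation `Γ(W') → Γ(D(f'))` being injective
  haveI := hW'.isLocalization_basicOpen f'
  have hinj : Function.Injective (algebraMap Γ(X, W') Γ(X, X.basicOpen f')) :=
    IsLocalization.injective _ (Submonoid.powers_le.mpr hf')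
  apply hinj
  rw [map_zero]
  change (X.presheaf.map (homOfLE hW'W).op ≫ X.presheaf.map (homOfLE (X.basicOpen_le f')).op) s = 0
  rw [← Functor.map_comp, ← op_comp, homOfLE_comp]
  exact hsD

/-- **The complement of an effective Cartier divisor is scheme-theoretically dense**: the open
immersion `X ∖ V(K) ↪ X` is scheme-theoretically dominant (its kernel ideal sheaf vanishes).
[cite: StacksProject, Tag 07ZU] -/
theorem IsEffectiveCartier.isSchemeTheoreticallyDominant_ι_centreCompl (hK : IsEffectiveCartier K) :
    IsSchemeTheoreticallyDominant (centreCompl K).ι := by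
  haveI := hK.quasiCompact_ι_centreCompl
  refine ⟨Scheme.IdealSheafData.ext (funext fun W => ?_)⟩
  rw [Scheme.Hom.ker_apply, Scheme.IdealSheafData.ideal_bot, Pi.bot_apply,
    ← RingHom.injective_iff_ker_eq_bot]
  exact hK.app_ι_centreCompl_injective W

/-- **For a flat `g : T → S'` and an effective Cartier divisor `E = V(K)` of `S'`, the open
`g⁻¹(S' ∖ E) ⊆ T` is scheme-theoretically dense** (flat base change of the quasi-compact,
scheme-theoretically dominant `S' ∖ E ↪ S'`). [folklore] -/
theorem isSchemeTheoreticallyDominant_ι_preimage_centreCompl {T S' : Scheme.{u}} (g : T ⟶ S')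
    [Flat g] {K : S'.IdealSheafData} (hK : IsEffectiveCartier K) :
    IsSchemeTheoreticallyDominant (g ⁻¹ᵁ centreCompl K).ι :=
  haveI := hK.quasiCompact_ι_centreCompl
  haveI := hK.isSchemeTheoreticallyDominant_ι_centreCompl
  IsSchemeTheoreticallyDominant.of_isPullback (isPullback_morphismRestrict g (centreCompl K))

end Cartier

/-! ## Uniqueness of the strict transform along a blowing up -/

section Unique

variable {T S' : Scheme.{u}} (g : T ⟶ S') {K : S'.IdealSheafData}

/-- **Uniqueness of the strict transform along a blowing up.** Let `E = V(K)` be an effective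
Cartier divisor of `S'` (e.g. the exceptional divisor of a blowing up `S' → S`) and `g : T → S'`.
A closed subscheme `Z = V(J)` of `T` which is FLAT over `S'` and contains the scheme-theoretic
closure of `T|_{g⁻¹(S' ∖ E)}` (`J ≤ ker`) equals that closure (`J = ker`): the part of `Z` over
`S' ∖ E` is scheme-theoretically dense in `Z` and maps into `T|_{g⁻¹(S' ∖ E)}`. (The analogue,
for blowing ups, of de Jong 1996, 2.18, last sentence — `strictTransform_unique` — where the
base is integral and the dense open is the generic fibre.) [folklore] -/
theorem eq_ker_ι_preimage_centreCompl_of_flat (hK : IsEffectiveCartier K) (O : S'.Opens)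
    (hO : O = centreCompl K) (J : T.IdealSheafData) [Flat (J.subschemeι ≫ g)]
    (hJ : J ≤ (g ⁻¹ᵁ O).ι.ker) : J = (g ⁻¹ᵁ O).ι.ker := by
  subst hO
  refine le_antisymm hJ ?_
  haveI := isSchemeTheoreticallyDominant_ι_preimage_centreCompl (J.subschemeι ≫ g) hK
  have hrange : Set.range (((J.subschemeι ≫ g) ⁻¹ᵁ centreCompl K).ι ≫ J.subschemeι) ⊆
      Set.range (g ⁻¹ᵁ centreCompl K).ι := by
    rintro _ ⟨z, rfl⟩
    rw [Scheme.Opens.range_ι]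
    exact z.2
  calc (g ⁻¹ᵁ centreCompl K).ι.ker
      ≤ (IsOpenImmersion.lift (g ⁻¹ᵁ centreCompl K).ι _ hrange ≫ (g ⁻¹ᵁ centreCompl K).ι).ker :=
        Scheme.Hom.le_ker_comp _ _
    _ = (((J.subschemeι ≫ g) ⁻¹ᵁ centreCompl K).ι ≫ J.subschemeι).ker := by
        rw [IsOpenImmersion.lift_fac]
    _ = J := by
        rw [Scheme.Hom.ker_comp, Scheme.Hom.ker_eq_bot, Scheme.IdealSheafData.map_bot,
          Scheme.IdealSheafData.ker_subschemeι]

/-- A morphism factors through its scheme-theoretic image: `f⁻¹(ker f) 𝒪_X = 0`. [folklore] -/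
theorem comap_ker_self_eq_bot {X Y : Scheme.{u}} (f : X ⟶ Y) : f.ker.comap f = ⊥ := by
  let s : X ⟶ pullback f f.imageι := pullback.lift (𝟙 X) f.toImage (by simp)
  have hs : s ≫ pullback.fst f f.imageι = 𝟙 X := pullback.lift_fst _ _ _
  refine le_bot_iff.mp ?_
  calc f.ker.comap f = (pullback.fst f f.imageι).ker := rfl
    _ ≤ (s ≫ pullback.fst f f.imageι).ker := Scheme.Hom.le_ker_comp _ _
    _ = ⊥ := by rw [hs, Scheme.Hom.ker_eq_bot_of_isIso]

end Unique

/-! ## Persistence of flat strict transforms under dominating blowing ups -/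

section Persistence

variable {X S S' Sᵢ : Scheme.{u}} (f : X ⟶ S) (bᵢ : Sᵢ ⟶ S) (Iᵢ : S.IdealSheafData)
  (g : S' ⟶ Sᵢ) (b : S' ⟶ S) (I : S.IdealSheafData)

/-- The comparison map `X ×_S S' → X ×_S Sᵢ` over `g : S' → Sᵢ` (for `b = g ≫ bᵢ`). [folklore] -/
def strictTransformComparison (hcomm : g ≫ bᵢ = b) : pullback f b ⟶ pullback f bᵢ :=
  pullback.map f b f bᵢ (𝟙 X) g (𝟙 S) (by rw [Category.comp_id, Category.id_comp])
    (by rw [Category.comp_id, hcomm])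

variable {f bᵢ g b}

/-- `X ×_S S' → X ×_S Sᵢ → Sᵢ` is `X ×_S S' → S' → Sᵢ`. [folklore] -/
@[reassoc]
theorem strictTransformComparison_snd (hcomm : g ≫ bᵢ = b) :
    strictTransformComparison f bᵢ g b hcomm ≫ pullback.snd f bᵢ = pullback.snd f b ≫ g :=
  pullback.lift_snd _ _ _

/-- `X ×_S S' → X ×_S Sᵢ → X` is the first projection. [folklore] -/
@[reassoc]
theorem strictTransformComparison_fst (hcomm : g ≫ bᵢ = b) :
    strictTransformComparison f bᵢ g b hcomm ≫ pullback.fst f bᵢ = pullback.fst f b := by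
  rw [strictTransformComparison, pullback.lift_fst, Category.comp_id]

/-- `X ×_S S' = (X ×_S Sᵢ) ×_{Sᵢ} S'`: the comparison square is cartesian. [folklore] -/
theorem isPullback_strictTransformComparison (hcomm : g ≫ bᵢ = b) :
    IsPullback (strictTransformComparison f bᵢ g b hcomm) (pullback.snd f b) (pullback.snd f bᵢ) g := by
  refine IsPullback.of_right ?_ (strictTransformComparison_snd hcomm) (IsPullback.of_hasPullback f bᵢ)
  rw [strictTransformComparison_fst, hcomm]
  exact IsPullback.of_hasPullback f b

/-- `b⁻¹(S ∖ V(𝓘)) = S' ∖ V(b⁻¹𝓘 𝒪_{S'})`. [folklore] -/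
theorem preimage_centreCompl (b : S' ⟶ S) (I : S.IdealSheafData) :
    b ⁻¹ᵁ centreCompl I = centreCompl (I.comap b) := by
  ext x
  simp [centreCompl, Scheme.IdealSheafData.support_comap]

variable (f bᵢ g b) in
/-- **The strict transform along a dominating blowing up is the base change of a flat strict
transform.** Let `b = g ≫ bᵢ`, `Supp 𝓘ᵢ ⊆ Supp 𝓘`, and assume `b⁻¹𝓘 𝒪_{S'}` is an effective
Cartier divisor (e.g. `b` a blowing up of `S` in `𝓘`) and the strict transform `X'ᵢ → Sᵢ` of
`f : X → S` along `bᵢ` (Stacks 080D, with respect to `V(𝓘ᵢ)`) is flat. Then the ideal sheaf of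
the strict transform of `f` along `b` (with respect to `V(𝓘)`) in `X ×_S S'` is the pull-back of
the ideal sheaf of `X'ᵢ ⊆ X ×_S Sᵢ` along `X ×_S S' → X ×_S Sᵢ`, i.e. the strict transform is
`X'ᵢ ×_{Sᵢ} S'`: the latter is closed in `X ×_S S'`, flat over `S'` and equal to `X ×_S S'` over
`g⁻¹(bᵢ⁻¹(S ∖ V(𝓘ᵢ))) ⊇ b⁻¹(S ∖ V(𝓘))`, so `eq_ker_ι_preimage_centreCompl_of_flat` applies.
[cite: StacksProject, Tag 081R (proof)] -/
theorem ker_blowupStrictTransformι_eq_comap (hcomm : g ≫ bᵢ = b)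
    (hsupp : (Iᵢ.support : Set S) ⊆ I.support) (hE : IsEffectiveCartier (I.comap b))
    [Flat (blowupStrictTransformMap f bᵢ Iᵢ)] :
    (blowupStrictTransformι f b I).ker =
      ((pullback.snd f bᵢ) ⁻¹ᵁ (bᵢ ⁻¹ᵁ centreCompl Iᵢ)).ι.ker.comap
        (strictTransformComparison f bᵢ g b hcomm) := by
  rw [ker_blowupStrictTransformι]
  -- (i) `X'ᵢ ×_{Sᵢ} S'` is flat over `S'`
  have hsq : IsPullback
      (pullback.snd (strictTransformComparison f bᵢ g b hcomm)
        ((pullback.snd f bᵢ) ⁻¹ᵁ (bᵢ ⁻¹ᵁ centreCompl Iᵢ)).ι.ker.subschemeι)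
      (pullback.fst (strictTransformComparison f bᵢ g b hcomm)
        ((pullback.snd f bᵢ) ⁻¹ᵁ (bᵢ ⁻¹ᵁ centreCompl Iᵢ)).ι.ker.subschemeι ≫ pullback.snd f b)
      (((pullback.snd f bᵢ) ⁻¹ᵁ (bᵢ ⁻¹ᵁ centreCompl Iᵢ)).ι.ker.subschemeι ≫ pullback.snd f bᵢ) g :=
    (IsPullback.of_hasPullback _ _).flip.paste_vert (isPullback_strictTransformComparison hcomm)
  haveI h1 : Flat (pullback.fst (strictTransformComparison f bᵢ g b hcomm)
      ((pullback.snd f bᵢ) ⁻¹ᵁ (bᵢ ⁻¹ᵁ centreCompl Iᵢ)).ι.ker.subschemeι ≫ pullback.snd f b) :=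
    MorphismProperty.of_isPullback hsq ‹Flat (blowupStrictTransformMap f bᵢ Iᵢ)›
  haveI hflat : Flat ((((pullback.snd f bᵢ) ⁻¹ᵁ (bᵢ ⁻¹ᵁ centreCompl Iᵢ)).ι.ker.comap
      (strictTransformComparison f bᵢ g b hcomm)).subschemeι ≫ pullback.snd f b) := by
    rw [← Scheme.IdealSheafData.comapIso_hom_fst, Category.assoc]
    infer_instance
  -- (ii) it is all of `X ×_S S'` over `O = b⁻¹(S ∖ V(I))`: `J|_O = 0`, as `O → X ×_S Sᵢ` factors
  -- through the open over `bᵢ⁻¹(S ∖ V(Iᵢ))`, on which the ideal of `X'ᵢ` vanishes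
  have hle : ((pullback.snd f bᵢ) ⁻¹ᵁ (bᵢ ⁻¹ᵁ centreCompl Iᵢ)).ι.ker.comap
      (strictTransformComparison f bᵢ g b hcomm) ≤
        ((pullback.snd f b) ⁻¹ᵁ (b ⁻¹ᵁ centreCompl I)).ι.ker := by
    rw [← Scheme.IdealSheafData.map_bot (((pullback.snd f b) ⁻¹ᵁ (b ⁻¹ᵁ centreCompl I)).ι),
      Scheme.IdealSheafData.le_map_iff_comap_le, le_bot_iff, ← Scheme.IdealSheafData.comap_comp]
    have hrange : Set.range (((pullback.snd f b) ⁻¹ᵁ (b ⁻¹ᵁ centreCompl I)).ι ≫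
        strictTransformComparison f bᵢ g b hcomm) ⊆
          Set.range ((pullback.snd f bᵢ) ⁻¹ᵁ (bᵢ ⁻¹ᵁ centreCompl Iᵢ)).ι := by
      rintro _ ⟨y, rfl⟩
      rw [Scheme.Opens.range_ι]
      have hy' : b (pullback.snd f b y.1) ∉ (I.support : Set S) := y.2
      show pullback.snd f bᵢ ((((pullback.snd f b) ⁻¹ᵁ (b ⁻¹ᵁ centreCompl I)).ι ≫
        strictTransformComparison f bᵢ g b hcomm) y) ∈ bᵢ ⁻¹ᵁ centreCompl Iᵢ
      rw [← Scheme.Hom.comp_apply, Category.assoc, strictTransformComparison_snd,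
        Scheme.Hom.comp_apply, Scheme.Hom.comp_apply]
      show bᵢ (g (pullback.snd f b (((pullback.snd f b) ⁻¹ᵁ (b ⁻¹ᵁ centreCompl I)).ι y))) ∉
        (Iᵢ.support : Set S)
      rw [← Scheme.Hom.comp_apply g bᵢ, hcomm]
      exact fun h => hy' (hsupp h)
    rw [← IsOpenImmersion.lift_fac _ _ hrange, Scheme.IdealSheafData.comap_comp, comap_ker_self_eq_bot,
      Scheme.IdealSheafData.comap_bot]
  -- (iii) uniqueness
  exact (eq_ker_ι_preimage_centreCompl_of_flat (pullback.snd f b) hE _ (preimage_centreCompl b I)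
    _ hle).symm

/-- **Persistence of flat strict transforms: properties stable under base change.** In the
situation of `ker_blowupStrictTransformι_eq_comap` (`b = g ≫ bᵢ`, `Supp 𝓘ᵢ ⊆ Supp 𝓘`, `b⁻¹𝓘 𝒪_{S'}`
an effective Cartier divisor, the strict transform `X'ᵢ → Sᵢ` along `bᵢ` flat), every property
`P` of morphisms which is stable under base change and holds for `X'ᵢ → Sᵢ` holds for the strict
transform of `X → S` along `b` (which is `X'ᵢ ×_{Sᵢ} S' → S'`); e.g. `P = Flat`,
`P = LocallyOfFinitePresentation`. [cite: StacksProject, Tag 081R (proof)] -/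
theorem blowupStrictTransformMap_of_dominating (P : MorphismProperty Scheme.{u})
    [P.IsStableUnderBaseChange] [P.RespectsIso] (hcomm : g ≫ bᵢ = b)
    (hsupp : (Iᵢ.support : Set S) ⊆ I.support) (hE : IsEffectiveCartier (I.comap b))
    [Flat (blowupStrictTransformMap f bᵢ Iᵢ)] (hP : P (blowupStrictTransformMap f bᵢ Iᵢ)) :
    P (blowupStrictTransformMap f b I) := by
  have key := ker_blowupStrictTransformι_eq_comap f bᵢ Iᵢ g b I hcomm hsupp hE
  rw [ker_blowupStrictTransformι] at key
  have hsq : IsPullback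
      (pullback.snd (strictTransformComparison f bᵢ g b hcomm)
        ((pullback.snd f bᵢ) ⁻¹ᵁ (bᵢ ⁻¹ᵁ centreCompl Iᵢ)).ι.ker.subschemeι)
      (pullback.fst (strictTransformComparison f bᵢ g b hcomm)
        ((pullback.snd f bᵢ) ⁻¹ᵁ (bᵢ ⁻¹ᵁ centreCompl Iᵢ)).ι.ker.subschemeι ≫ pullback.snd f b)
      (((pullback.snd f bᵢ) ⁻¹ᵁ (bᵢ ⁻¹ᵁ centreCompl Iᵢ)).ι.ker.subschemeι ≫ pullback.snd f bᵢ) g :=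
    (IsPullback.of_hasPullback _ _).flip.paste_vert (isPullback_strictTransformComparison hcomm)
  have h1 : P (pullback.fst (strictTransformComparison f bᵢ g b hcomm)
      ((pullback.snd f bᵢ) ⁻¹ᵁ (bᵢ ⁻¹ᵁ centreCompl Iᵢ)).ι.ker.subschemeι ≫ pullback.snd f b) :=
    P.of_isPullback hsq hP
  have h2 : P ((((pullback.snd f bᵢ) ⁻¹ᵁ (bᵢ ⁻¹ᵁ centreCompl Iᵢ)).ι.ker.comap
      (strictTransformComparison f bᵢ g b hcomm)).subschemeι ≫ pullback.snd f b) := by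
    rw [← Scheme.IdealSheafData.comapIso_hom_fst, Category.assoc]
    exact (P.cancel_left_of_respectsIso _ _).mpr h1
  rw [← key] at h2
  exact h2

/-- **Persistence of flat strict transforms: flatness.** In the same situation the strict
transform of `X → S` along `b` is flat over `S'`. [cite: StacksProject, Tag 081R (proof)] -/
theorem flat_blowupStrictTransformMap_of_dominating (hcomm : g ≫ bᵢ = b)
    (hsupp : (Iᵢ.support : Set S) ⊆ I.support) (hE : IsEffectiveCartier (I.comap b))
    [Flat (blowupStrictTransformMap f bᵢ Iᵢ)] : Flat (blowupStrictTransformMap f b I) :=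
  blowupStrictTransformMap_of_dominating Iᵢ I @Flat hcomm hsupp hE ‹_›

/-- **Persistence of flat strict transforms: local finite presentation.** In the same situation,
if `X'ᵢ → Sᵢ` is moreover locally of finite presentation then so is the strict transform of
`X → S` along `b`. [cite: StacksProject, Tag 081R (proof)] -/
theorem locallyOfFinitePresentation_blowupStrictTransformMap_of_dominating (hcomm : g ≫ bᵢ = b)
    (hsupp : (Iᵢ.support : Set S) ⊆ I.support) (hE : IsEffectiveCartier (I.comap b))
    [Flat (blowupStrictTransformMap f bᵢ Iᵢ)]
    [LocallyOfFinitePresentation (blowupStrictTransformMap f bᵢ Iᵢ)] :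
    LocallyOfFinitePresentation (blowupStrictTransformMap f b I) :=
  blowupStrictTransformMap_of_dominating Iᵢ I @LocallyOfFinitePresentation hcomm hsupp hE ‹_›

end Persistence

end Literature.AlgebraicGeometry.Resolution

end
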